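import Summits.BirchSwinnertonDyer.BirchSwinnertonDyer.Theorems.SylvesterTwoHeegnerIndexCoupledTelescopeLifts
import Literature.GroupTheory.FiniteAbelian.IndependentGenerators
import HarnessLib

/-!
# The COUPLED Cassels–Tate telescope, IX: a `ℤ`-BASIS of the `ℚ`-Lagrangian and its descended
# `𝒪`-basis (the families `d_i = r(g_i)` behind hT's lifts; pure algebra)

Companion of `…CoupledTelescope{Lifts,Lagrangian,LagrangianSha}` (crux `UpperOffV0HSYPlus`,
stmt-BirchSwinnertonDyer-19804; census theorems p699147 / p699428).  After `…LagrangianSha`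
(`exists_coisotropic_lagrangian_sha`: `B₂, r, w, L`, `D = closure (r(L) ∪ w '' r(L))` isotropic and
coisotropic) the rows still owe hT's LIFT family: `𝒪`-independent Selmer lifts of exact orders whose
images span `D`.  McCallum (p. 288) writes `D = D₁ × D₂ × ⋯` with cyclic `D_i` and lifts generators;
in the coupled `p = 2` setting the generators are `d_i := r(g_i)` for a `ℤ`-BASIS `g_i` of the
`ℚ`-Lagrangian `L` (memo two §59.1 (iii): `D = D₀ ⊗ 𝒪`).  This file supplies, ABSTRACTLY:

* `exists_basis_two_primary` — a finite additive `2`-group `G` has an `ℕ`-indexed basis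
  `g_0, …, g_{m-1}` with orders `2^{N_i}`: `2^{N_i} g_i = 0`, `∑ γ_i g_i = 0 ⟹ 2^{N_i} ∣ γ_i`, and
  every `x` is `∑ γ_i g_i` (the structure theorem, via the tree's
  `FiniteAbelian.exists_indep_generators`, re-indexed by `ℕ`).
* `descended_basis` — for additive `r : G → Q`, `w' : Q → Q` with `r` injective and the descent
  injectivity `r c + w' (r d) = 0 ⟹ c = d = 0` (LEMMA K0, #K7/#K8's bijection): the images
  `d_i := r(g_i)` satisfy `2^{N_i} d_i = 0`, the `𝒪`-INDEPENDENCE WITH EXACT ANNIHILATORS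
  `∑ (α_i d_i + β_i w' d_i) = 0 ⟹ 2^{N_i} ∣ α_i, β_i` (= the `hindQ` input of #K5's
  `indep_of_indep_image` / `pow_sub_one_smul_ne_zero_of_indep_image`), and GENERATION
  `closure (r(G) ∪ w' '' r(G)) = closure ({d_i} ∪ w' '' {d_i})` (so hT's (gen) clause reads off the
  lifts of the `d_i`).

Theorem-only (no definition, no named fact); pure algebra; nothing asserted on 19804; BSD not claimed.
Sources: McCallum 1991 (LMS LN 153) §5 p. 288; MEMO-bsd-cm-two §59.1 (iii), §64.5 SET-UP.
-/

-- every Summits module is named `Summit.<Summit>.<Problem>…`: the duplicated component is by design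
set_option linter.dupNamespace false
set_option autoImplicit false

open scoped Classical

namespace Summit.BirchSwinnertonDyer.BirchSwinnertonDyer.Theorems.SylvesterTwoCoupledTelescope

section Basis

variable {G : Type*} [AddCommGroup G]

/-- In a `2`-primary group every element has order a power of `2`, namely `2^{ord₂(ord x)}`.
[folklore] -/
theorem addOrderOf_eq_two_pow (hprim : ∀ x : G, ∃ k : ℕ, ((2 : ℤ) ^ k) • x = 0) (x : G) :
    addOrderOf x = 2 ^ padicValNat 2 (addOrderOf x) := by
  obtain ⟨k, hk⟩ := hprim x
  have hdvd : addOrderOf x ∣ 2 ^ k := by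
    apply addOrderOf_dvd_of_nsmul_eq_zero
    have : ((2 ^ k : ℕ) : ℤ) • x = 0 := by exact_mod_cast hk
    rwa [natCast_zsmul] at this
  obtain ⟨j, -, hj⟩ := (Nat.dvd_prime_pow Nat.prime_two).mp hdvd
  rw [hj, padicValNat.prime_pow]

/-- **A `ℤ`-basis of a finite additive `2`-group, indexed by `ℕ`, with orders `2^{N_i}`** (structure
theorem; the tree's `FiniteAbelian.exists_indep_generators` re-indexed): `2^{N_i} g_i = 0`,
`∑_{i<m} γ_i g_i = 0 ⟹ 2^{N_i} ∣ γ_i`, every `x = ∑_{i<m} γ_i g_i`.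
[cite: McCallumLMS1991, §5 (p. 288, p. 312)] -/
theorem exists_basis_two_primary [Finite G] (hprim : ∀ x : G, ∃ k : ℕ, ((2 : ℤ) ^ k) • x = 0) :
    ∃ (m : ℕ) (g : ℕ → G) (N : ℕ → ℕ),
      (∀ i, ((2 : ℤ) ^ N i) • g i = 0) ∧
      (∀ γ : ℕ → ℤ, ∑ i ∈ Finset.range m, γ i • g i = 0 →
        ∀ i ∈ Finset.range m, ((2 : ℤ) ^ N i) ∣ γ i) ∧
      (∀ x : G, ∃ γ : ℕ → ℤ, x = ∑ i ∈ Finset.range m, γ i • g i) := by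
  obtain ⟨ι, _, g₀, hind, hgen⟩ := Literature.GroupTheory.FiniteAbelian.exists_indep_generators (G := G)
  let e : ι ≃ Fin (Fintype.card ι) := Fintype.equivFin ι
  let m := Fintype.card ι
  let g : ℕ → G := fun i ↦ if h : i < m then g₀ (e.symm ⟨i, h⟩) else 0
  let N : ℕ → ℕ := fun i ↦ padicValNat 2 (addOrderOf (g i))
  have hord : ∀ i, addOrderOf (g i) = 2 ^ N i := fun i ↦ addOrderOf_eq_two_pow hprim (g i)
  have hgi : ∀ j : ι, g (e j) = g₀ j := fun j ↦ by
    have h : ((e j : ℕ)) < m := (e j).2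
    show (if h' : ((e j : ℕ)) < m then g₀ (e.symm ⟨(e j : ℕ), h'⟩) else 0) = g₀ j
    rw [dif_pos h, Fin.eta, Equiv.symm_apply_apply]
  -- re-indexing a sum over `range m` through `e`
  have hsum : ∀ (γ : ℕ → ℤ), ∑ i ∈ Finset.range m, γ i • g i = ∑ j : ι, γ (e j) • g₀ j := by
    intro γ
    rw [Finset.sum_range (fun i ↦ γ i • g i), ← Equiv.sum_comp e (fun i : Fin m ↦ γ i • g i)]
    refine Finset.sum_congr rfl fun j _ ↦ ?_
    rw [hgi]
  refine ⟨m, g, N, fun i ↦ ?_, fun γ hγ i hi ↦ ?_, fun x ↦ ?_⟩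
  · have h := addOrderOf_nsmul_eq_zero (g i)
    rw [hord] at h
    have : (((2 ^ N i : ℕ) : ℤ)) • g i = 0 := by rw [natCast_zsmul]; exact h
    exact_mod_cast this
  · rw [hsum] at hγ
    have hi' : i < m := Finset.mem_range.mp hi
    have h := hind (fun j ↦ γ (e j)) hγ (e.symm ⟨i, hi'⟩)
    have hei : ((e (e.symm ⟨i, hi'⟩) : Fin m) : ℕ) = i := by rw [Equiv.apply_symm_apply]
    have hgi' : g₀ (e.symm ⟨i, hi'⟩) = g i := by
      rw [← hgi (e.symm ⟨i, hi'⟩), hei]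
    have h' : ((addOrderOf (g i) : ℕ) : ℤ) ∣ γ i := by
      have h'' : ((addOrderOf (g₀ (e.symm ⟨i, hi'⟩)) : ℕ) : ℤ) ∣ γ ((e (e.symm ⟨i, hi'⟩) : Fin m) : ℕ) :=
        h
      rwa [hei, hgi'] at h''
    rw [hord] at h'
    exact_mod_cast h'
  · obtain ⟨a, ha⟩ := hgen x
    refine ⟨fun i ↦ if h : i < m then a (e.symm ⟨i, h⟩) else 0, ?_⟩
    rw [hsum, ha]
    refine Finset.sum_congr rfl fun j _ ↦ ?_
    show a j • g₀ j = (if h : ((e j : ℕ)) < m then a (e.symm ⟨(e j : ℕ), h⟩) else 0) • g₀ j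
    rw [dif_pos (e j).2, Fin.eta, Equiv.symm_apply_apply]

end Basis

section Descended

variable {G Q : Type*} [AddCommGroup G] [AddCommGroup Q]

/-- **The descended `𝒪`-basis `d_i = r(g_i)`**: for `r : G → Q` injective, `w' : Q → Q` additive with
the descent injectivity `r c + w' (r d) = 0 ⟹ c = 0 ∧ d = 0` (LEMMA K0), and a `ℤ`-basis `g_i`
(`i < m`) of `G` with orders `2^{N_i}`: the images `d_i := r (g_i)` are killed by `2^{N_i}`, are
`𝒪`-INDEPENDENT WITH EXACT ANNIHILATORS — `∑ (α_i d_i + β_i w' d_i) = 0 ⟹ 2^{N_i} ∣ α_i, β_i` (the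
`hindQ` input of `…CoupledTelescopeLifts`) — and `𝒪`-GENERATE the descended subgroup:
`closure (r(G) ∪ w' '' r(G)) = closure ({d_i} ∪ w' '' {d_i})`.
[cite: McCallumLMS1991, §5 (p. 288)] -/
theorem descended_basis (r : G →+ Q) (w' : Q →+ Q) (hrinj : Function.Injective r)
    (hdesc : ∀ c d : G, r c + w' (r d) = 0 → c = 0 ∧ d = 0)
    {m : ℕ} {g : ℕ → G} {N : ℕ → ℕ} (hN : ∀ i, ((2 : ℤ) ^ N i) • g i = 0)
    (hind : ∀ γ : ℕ → ℤ, ∑ i ∈ Finset.range m, γ i • g i = 0 →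
      ∀ i ∈ Finset.range m, ((2 : ℤ) ^ N i) ∣ γ i)
    (hgen : ∀ x : G, ∃ γ : ℕ → ℤ, x = ∑ i ∈ Finset.range m, γ i • g i) :
    (∀ i, ((2 : ℤ) ^ N i) • r (g i) = 0) ∧
    (∀ α β : ℕ → ℤ, ∑ i ∈ Finset.range m, (α i • r (g i) + β i • w' (r (g i))) = 0 →
      ∀ i ∈ Finset.range m, ((2 : ℤ) ^ N i) ∣ α i ∧ ((2 : ℤ) ^ N i) ∣ β i) ∧
    AddSubgroup.closure (Set.range r ∪ w' '' Set.range r) =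
      AddSubgroup.closure (((((Finset.range m).image (fun i ↦ r (g i))) : Finset Q) : Set Q) ∪
        w' '' ((((Finset.range m).image (fun i ↦ r (g i))) : Finset Q) : Set Q)) := by
  refine ⟨fun i ↦ by rw [← map_zsmul, hN i, map_zero], ?_, ?_⟩
  · -- independence with exact annihilators through the descent
    refine indep_image_of_descent (p := 2) w' r.range (fun a ha b hb hab ↦ ?_) (fun i ↦ r (g i)) N
      (Finset.range m) (fun i _ ↦ AddMonoidHom.mem_range.mpr ⟨g i, rfl⟩) (fun γ hγ ↦ ?_)
    · obtain ⟨c, rfl⟩ := ha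
      obtain ⟨d, rfl⟩ := hb
      obtain ⟨hc, hd⟩ := hdesc c d hab
      exact ⟨by rw [hc, map_zero], by rw [hd, map_zero]⟩
    · apply hind γ
      apply hrinj
      rw [map_sum, map_zero]
      simpa only [map_zsmul] using hγ
  · -- generation: both closures coincide
    apply le_antisymm
    · refine (AddSubgroup.closure_le _).mpr ?_
      rintro q hq
      have hmem : ∀ c : G, r c ∈ AddSubgroup.closure
          (((((Finset.range m).image (fun i ↦ r (g i))) : Finset Q) : Set Q) ∪
            w' '' ((((Finset.range m).image (fun i ↦ r (g i))) : Finset Q) : Set Q)) := by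
        intro c
        obtain ⟨γ, rfl⟩ := hgen c
        rw [map_sum]
        refine AddSubgroup.sum_mem _ fun i hi ↦ ?_
        rw [map_zsmul]
        exact AddSubgroup.zsmul_mem _ (AddSubgroup.subset_closure (Set.mem_union_left _
          (by rw [Finset.coe_image]; exact ⟨i, Finset.mem_coe.mpr hi, rfl⟩))) _
      have hwmem : ∀ c : G, w' (r c) ∈ AddSubgroup.closure
          (((((Finset.range m).image (fun i ↦ r (g i))) : Finset Q) : Set Q) ∪
            w' '' ((((Finset.range m).image (fun i ↦ r (g i))) : Finset Q) : Set Q)) := by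
        intro c
        obtain ⟨γ, rfl⟩ := hgen c
        rw [map_sum, map_sum]
        refine AddSubgroup.sum_mem _ fun i hi ↦ ?_
        rw [map_zsmul, map_zsmul]
        have hri : r (g i) ∈ ((((Finset.range m).image (fun i ↦ r (g i))) : Finset Q) : Set Q) := by
          rw [Finset.coe_image]; exact ⟨i, Finset.mem_coe.mpr hi, rfl⟩
        exact AddSubgroup.zsmul_mem _ (AddSubgroup.subset_closure (Set.mem_union_right _
          (Set.mem_image_of_mem w' hri))) _
      rcases hq with ⟨c, rfl⟩ | ⟨_, ⟨c, rfl⟩, rfl⟩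
      · exact hmem c
      · exact hwmem c
    · refine (AddSubgroup.closure_le _).mpr ?_
      rintro q hq
      rw [Finset.coe_image] at hq
      rcases hq with ⟨i, -, rfl⟩ | ⟨_, ⟨i, -, rfl⟩, rfl⟩
      · exact AddSubgroup.subset_closure (Set.mem_union_left _ (Set.mem_range_self (g i)))
      · exact AddSubgroup.subset_closure
          (Set.mem_union_right _ (Set.mem_image_of_mem w' (Set.mem_range_self (g i))))

end Descended

end Summit.BirchSwinnertonDyer.BirchSwinnertonDyer.Theorems.SylvesterTwoCoupledTelescope
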